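import Literature.NumberTheory.EllipticCurves.BigRepLocalTermFrameProofs
import Literature.NumberTheory.EllipticCurves.BigRepShiftedEndomorphismModelsProofs
import Literature.NumberTheory.EllipticCurves.BigRepModuleDualShiftedEndomorphismCofinitelyGeneratedProofs
import Literature.NumberTheory.EllipticCurves.IwasawaSelmerIsTorsionProofs
import Literature.NumberTheory.EllipticCurves.SelmerCocycleLiftUnramifiedFiniteProofs
import HarnessLib

/-!
# The local term of the big representation at a FINITELY DECOMPOSED place, GENERAL (cofinitely
# generated) case: `H¹(G, T ⊗ Λ^*(Ψ⁻¹))^∨` is finitely generated and torsion over `Λ`, and its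
# characteristic ideal contains `P((1+T)^{−κψ})`, `P = (charpoly of ψ on (H¹(N, A)^∨)/tors).reverse`

Topic `NumberTheory/EllipticCurves`; namespace `Literature.NumberTheory.EllipticCurves.BigGaloisRep`.
THEOREMS ONLY (no definition, no named fact, no `sorry`). Cell `bsd-stepL`, K2 support 20495
(`JSWSigmaLocalCharIdeal`), module L5 (the `c ≠ 0` places of GOOD and MULTIPLICATIVE reduction);
seat `bsd-stepL-imc-p1` g13, assembling the typer lane's `Λ`-algebra (`defn-ty1` g10).

Setting: `G` a topological group, `κ : G →ₜ* ℤ_p`, `ρ : G → Aut_{ℤ_p}(A)` continuous on a discrete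
`p`-primary `A`, `M = bigRep κ ρ = A ⊗ Λ^*(κ⁻¹)` (`BigRepModule ℤ_[p] p A`), `N ⊴ G` compact with
`κ(N) = 1`, `ψ ∈ G` with `c := κ(ψ) ≠ 0` and `N·⟨ψ⟩` dense (a finitely decomposed place: `G = Γ_{K_w}`,
`N = I_w`, `ψ = Frob_w`). ASSUME the two coefficient modules `A^N` and `H¹(N, A)` are COFINITELY
GENERATED (`Module.Finite ℤ_[p] (CharacterModule _)`; for `A = E[p^∞]`, `w ∤ p`, both hold: `A[p]` and
`H¹(I_w, A)[p]` are finite).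

* `moduleFinite_isTorsion_mem_charIdeal_dual_h1_bigRep_of_cofinitelyGenerated` — **`H¹(G, M)^∨` is a
  finitely generated torsion `Λ`-module and `Ch_Λ(H¹(G, M)^∨) ∋ aeval ((1+T)^{−c}) (charpoly Lt).reverse`**
  for every endomorphism `Lt` of `Y = H¹(N, A)^∨ ⧸ tors` induced by the dual of the conjugation action
  `ψ·` on `H¹(N, A)` (such `Lt` exist: `BigRepModule.exists_quotientTorsion_endo_dual`).

Proof = the tree's three pieces: the FRAME `moduleFinite_isTorsion_mem_charIdeal_dual_h1_bigRep_of_shift_data`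
(`BigRepLocalTermFrameProofs`: (S2) `M^N ⧸ (ψ − 1)M^N` finite + (S3) the dual of the `ψ`-fixed classes of
`H¹(N, M)` f.g. torsion `∋ P` ⟹ the conclusion), the MODELS `exists_linearEquiv_invariantsOf_bigRep`,
`exists_linearEquiv_h1_subgroupRep_bigRep_conjMap` (`BigRepShiftedEndomorphismModelsProofs`: `M^N ≅ L(A^N)`,
`H¹(N, M) ≅ L(H¹(N, A))` with `ψ` the shifted endomorphism `Φ ↦ τ_{−c} F_* Φ`), and the `Λ`-ALGEBRA of
the shifted endomorphism on `L(B)` for cofinitely generated `B`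
(`BigRepModule.finite_quotient_range_shiftedEndo_of_moduleFinite`,
`BigRepModule.finite_isTorsion_charIdeal_characterModule_ker_shiftedEndo_eq_span_aeval`,
`BigRepModuleDualShiftedEndomorphismCofinitelyGeneratedProofs`). Transport of kernels ∕ cokernels ∕
duals ∕ characteristic ideals along the model isomorphisms is the only new content.

This is [GreenbergVatsal2000] Prop. 2.4 ∕ [GreenbergLNM1716] §3 in the co-induced model, with the
Euler factor in its INTRINSIC form `P_w(X) = det(1 − X·ψ | Y)`; the identification of `P_w((1+T)^{−c})`
with the tree's `SigmaEulerFactors.eulerFactor` (up to a unit) by reduction type is NOT in this file.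

References: [GreenbergVatsal2000] Prop. 2.4 and proof (arXiv pp. 21–23); [GreenbergLNM1716] §3;
[Skinner2016PacificMC] §2.3 (p. 180); [Washington1997] §13.2.
-/

noncomputable section

open scoped Classical Pointwise

open CategoryTheory Multiplicative

namespace Literature.NumberTheory.EllipticCurves.BigGaloisRep

open Literature.NumberTheory.GaloisRepresentations BigRepModule _root_.Subgroup

variable {p : ℕ} [hp : Fact p.Prime] {A : Type} [AddCommGroup A] [Module ℤ_[p] A]
  [TopologicalSpace A] [DiscreteTopology A] [ContinuousSMul ℤ_[p] A]
  {G : Type} [Group G] [TopologicalSpace G] [IsTopologicalGroup G]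
  [TopologicalSpace (PowerSeries ℤ_[p])] [ContinuousSMul (PowerSeries ℤ_[p]) (BigRepModule ℤ_[p] p A)]
  (κ : G →ₜ* Multiplicative ℤ_[p]) (ρ : ContinuousRep G ℤ_[p] A) (N : Subgroup G) [N.Normal]
  [CompactSpace N]

/-- Torsion transfers along a linear equivalence. [folklore] -/
private theorem isTorsion_of_linearEquiv {R : Type*} [CommRing R] {M₁ M₂ : Type*} [AddCommGroup M₁]
    [Module R M₁] [AddCommGroup M₂] [Module R M₂] (e : M₁ ≃ₗ[R] M₂) (h : Module.IsTorsion R M₁) :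
    Module.IsTorsion R M₂ := fun x => by
  obtain ⟨a, ha⟩ := @h (e.symm x)
  refine ⟨a, ?_⟩
  have : e (a • e.symm x) = e 0 := by rw [ha]
  rwa [map_zero, Submonoid.smul_def, map_smul, LinearEquiv.apply_symm_apply] at this

omit [DiscreteTopology A] [ContinuousSMul ℤ_[p] A] [IsTopologicalGroup G] [TopologicalSpace (PowerSeries ℤ_[p])]
  [ContinuousSMul (PowerSeries ℤ_[p]) (BigRepModule ℤ_[p] p A)] [CompactSpace N] in
/-- `ψ` preserves `A^N` for `N ⊴ G`. [cite: SerreGaloisCohomology1997, I §2.6 (the `G/H`-module `A^H`)] -/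
theorem apply_mem_invariantsOf_of_normal (ψ : G) (a : A) (ha : a ∈ ρ.invariantsOf N) :
    ρ ψ a ∈ ρ.invariantsOf N := by
  rw [ContinuousRep.mem_invariantsOf_iff] at ha ⊢
  intro n
  have hn' : ψ⁻¹ * (n : G) * ψ ∈ N := Subgroup.Normal.conj_mem' inferInstance (n : G) n.2 ψ
  have h2 : ρ (ψ⁻¹ * (n : G) * ψ) a = a := ha ⟨_, hn'⟩
  have e : (n : G) * ψ = ψ * (ψ⁻¹ * (n : G) * ψ) := by group
  rw [← Module.End.mul_apply, ← map_mul, e, map_mul, Module.End.mul_apply, h2]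

/-- **The finitely decomposed local term, cofinitely generated case** ([GreenbergVatsal2000] Prop. 2.4 in
the co-induced model, Euler factor in intrinsic form). See the module docstring.
[cite: GreenbergVatsal2000, Prop. 2.4 and proof (arXiv pp. 21–23)] [cite: GreenbergLNM1716, §3 (proof of Lemma 3.3)]
[cite: Skinner2016PacificMC, §2.3 (p. 180)] -/
theorem moduleFinite_isTorsion_mem_charIdeal_dual_h1_bigRep_of_cofinitelyGenerated
    (hκN : ∀ n ∈ N, κ n = 1) {ψ : G} (hψ : (κ ψ).toAdd ≠ 0)
    (hdense : Dense ((N : Set G) * (zpowers ψ : Set G)))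
    (hA : ∀ a : A, ∃ k : ℕ, p ^ k • a = 0)
    [Module.Finite ℤ_[p] (CharacterModule (ρ.invariantsOf N))]
    [Module.Finite ℤ_[p] (CharacterModule (continuousCohomology 1 (subgroupRep ρ.toTopRep N)))]
    (Lt : (CharacterModule (continuousCohomology 1 (subgroupRep ρ.toTopRep N)) ⧸
        Submodule.torsion ℤ_[p] (CharacterModule (continuousCohomology 1 (subgroupRep ρ.toTopRep N)))) →ₗ[ℤ_[p]]
      (CharacterModule (continuousCohomology 1 (subgroupRep ρ.toTopRep N)) ⧸
        Submodule.torsion ℤ_[p] (CharacterModule (continuousCohomology 1 (subgroupRep ρ.toTopRep N)))))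
    (hLt : ∀ χ : CharacterModule (continuousCohomology 1 (subgroupRep ρ.toTopRep N)),
      Lt (Submodule.Quotient.mk χ) = Submodule.Quotient.mk
        (CharacterModule.dual (conjMap ρ.toTopRep N ψ 1).hom.toLinearMap χ)) :
    Module.Finite (IwasawaAlgebra p) (CharacterModule (continuousCohomology 1 (bigRep κ ρ).toTopRep)) ∧
      Module.IsTorsion (IwasawaAlgebra p) (CharacterModule (continuousCohomology 1 (bigRep κ ρ).toTopRep)) ∧
      Polynomial.aeval (binomSeries ℤ_[p] (-(κ ψ).toAdd)) (LinearMap.charpoly Lt).reverse ∈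
        Module.charIdeal (IwasawaAlgebra p) (CharacterModule (continuousCohomology 1 (bigRep κ ρ).toTopRep)) := by
  have hc : -(κ ψ).toAdd ≠ 0 := neg_ne_zero.mpr hψ
  set X := (bigRep κ ρ).toTopRep with hX
  /- (S2): `M^N ⧸ (ψ − 1) M^N` is finite — transport of `finite_quotient_range_shiftedEndo_of_moduleFinite`
  along the model `e₁ : L(A^N) ≃ M^N`. -/
  have hψN : ∀ a ∈ ρ.invariantsOf N, ρ ψ a ∈ ρ.invariantsOf N :=
    fun a ha => apply_mem_invariantsOf_of_normal ρ N ψ a ha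
  set F₁ : ρ.invariantsOf N →ₗ[ℤ_[p]] ρ.invariantsOf N := (ρ ψ).restrict hψN with hF₁
  obtain ⟨e₁, -, he₁⟩ := exists_linearEquiv_invariantsOf_bigRep (𝒪 := ℤ_[p]) κ ρ N hκN
  set Sψ : (bigRep κ ρ).invariantsOf N →ₗ[PowerSeries ℤ_[p]] (bigRep κ ρ).invariantsOf N :=
    (((bigRep κ ρ).toTopRep.ρ ψ).toLinearMap - LinearMap.id :
      (BigRepModule ℤ_[p] p A) →ₗ[PowerSeries ℤ_[p]] BigRepModule ℤ_[p] p A).restrict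
      (shift_sub_mem_invariantsOf_bigRep κ ρ N ψ) with hSψ
  set E₁ : BigRepModule ℤ_[p] p (ρ.invariantsOf N) →ₗ[PowerSeries ℤ_[p]]
      BigRepModule ℤ_[p] p (ρ.invariantsOf N) :=
    e₁.symm.toLinearMap ∘ₗ Sψ ∘ₗ e₁.toLinearMap with hE₁def
  have hSe : ∀ Φ, Sψ (e₁ Φ) = e₁ (BigRepModule.translate (-(κ ψ).toAdd) (mapRange F₁ Φ) - Φ) := by
    intro Φ
    apply Subtype.ext
    rw [map_sub, AddSubgroupClass.coe_sub, ← he₁ ψ hψN Φ]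
    rfl
  have hE₁ : ∀ Φ, E₁ Φ = BigRepModule.translate (-(κ ψ).toAdd) (mapRange F₁ Φ) - Φ := by
    intro Φ
    change e₁.symm (Sψ (e₁ Φ)) = _
    rw [hSe, LinearEquiv.symm_apply_apply]
  have hB₁ : ∀ b : ρ.invariantsOf N, ∃ k : ℕ, p ^ k • b = 0 := fun b =>
    (hA b).imp fun k hk => Subtype.ext (by exact_mod_cast hk)
  obtain ⟨Lt₁, hLt₁⟩ := BigRepModule.exists_quotientTorsion_endo_dual F₁
  haveI hS2L : Finite (BigRepModule ℤ_[p] p (ρ.invariantsOf N) ⧸ LinearMap.range E₁) :=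
    BigRepModule.finite_quotient_range_shiftedEndo_of_moduleFinite hB₁ F₁ Lt₁ hLt₁ hc E₁ hE₁
  haveI : Finite ((bigRep κ ρ).invariantsOf N ⧸ LinearMap.range Sψ) := by
    have hle : LinearMap.range E₁ ≤ LinearMap.ker ((LinearMap.range Sψ).mkQ ∘ₗ e₁.toLinearMap) := by
      rintro _ ⟨Φ, rfl⟩
      rw [LinearMap.mem_ker, LinearMap.comp_apply, Submodule.mkQ_apply,
        Submodule.Quotient.mk_eq_zero]
      change e₁ (e₁.symm (Sψ (e₁ Φ))) ∈ LinearMap.range Sψ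
      rw [LinearEquiv.apply_symm_apply]
      exact LinearMap.mem_range_self _ _
    refine Finite.of_surjective ((LinearMap.range E₁).liftQ _ hle) ?_
    rw [← LinearMap.range_eq_top, Submodule.range_liftQ, LinearMap.range_eq_top]
    exact (Submodule.mkQ_surjective _).comp e₁.surjective
  /- (S3): the dual of the `ψ`-fixed classes of `H¹(N, M)` — transport of
  `finite_isTorsion_charIdeal_characterModule_ker_shiftedEndo_eq_span_aeval` along the model
  `e₂ : H¹(N, M) ≃ L(H¹(N, A))`. -/
  set F₂ : continuousCohomology 1 (subgroupRep ρ.toTopRep N) →ₗ[ℤ_[p]]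
      continuousCohomology 1 (subgroupRep ρ.toTopRep N) := (conjMap ρ.toTopRep N ψ 1).hom.toLinearMap
    with hF₂
  obtain ⟨e₂, -, he₂⟩ := exists_linearEquiv_h1_subgroupRep_bigRep_conjMap κ ρ N hκN hA
  set C : continuousCohomology 1 (subgroupRep X N) →ₗ[PowerSeries ℤ_[p]]
      continuousCohomology 1 (subgroupRep X N) :=
    (conjMap X N ψ 1).hom.toLinearMap - LinearMap.id with hCdef
  set E₂ : BigRepModule ℤ_[p] p (continuousCohomology 1 (subgroupRep ρ.toTopRep N)) →ₗ[PowerSeries ℤ_[p]]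
      BigRepModule ℤ_[p] p (continuousCohomology 1 (subgroupRep ρ.toTopRep N)) :=
    e₂.toLinearMap ∘ₗ C ∘ₗ e₂.symm.toLinearMap with hE₂def
  have hE₂ : ∀ Φ, E₂ Φ = BigRepModule.translate (-(κ ψ).toAdd) (mapRange F₂ Φ) - Φ := by
    intro Φ
    obtain ⟨y, rfl⟩ := e₂.surjective Φ
    change e₂ ((conjMap X N ψ 1).hom.toLinearMap (e₂.symm (e₂ y)) - LinearMap.id (e₂.symm (e₂ y))) = _
    rw [LinearEquiv.symm_apply_apply, map_sub, LinearMap.id_apply]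
    congr 1
    exact he₂ ψ y
  have hB₂ : ∀ b : continuousCohomology 1 (subgroupRep ρ.toTopRep N), ∃ k : ℕ, p ^ k • b = 0 := by
    intro b
    obtain ⟨k, hk⟩ := exists_pow_smul_eq_zero (subgroupRep ρ.toTopRep N) (p : ℤ_[p])
      (fun m => (hA m).imp fun k hk => by rw [← Nat.cast_pow, Nat.cast_smul_eq_nsmul]; exact hk) b
    exact ⟨k, by rw [← Nat.cast_smul_eq_nsmul (R := ℤ_[p]), Nat.cast_pow]; exact hk⟩
  obtain ⟨hfgE, htorsE, hChE⟩ :=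
    BigRepModule.finite_isTorsion_charIdeal_characterModule_ker_shiftedEndo_eq_span_aeval hB₂ F₂ Lt hLt
      hc E₂ hE₂
  -- `ker C ≃ ker E₂` along `e₂`
  have hkerEq : (LinearMap.ker C).map (e₂ : _ →ₗ[PowerSeries ℤ_[p]] _) = LinearMap.ker E₂ := by
    rw [Submodule.map_equiv_eq_comap_symm, hE₂def, LinearMap.ker_comp, LinearEquiv.ker,
      Submodule.comap_bot, LinearMap.ker_comp]
  let eK : LinearMap.ker C ≃ₗ[PowerSeries ℤ_[p]] LinearMap.ker E₂ :=
    (e₂.submoduleMap (LinearMap.ker C)).trans (LinearEquiv.ofEq _ _ hkerEq)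
  let eD : CharacterModule (LinearMap.ker C) ≃ₗ[PowerSeries ℤ_[p]] CharacterModule (LinearMap.ker E₂) :=
    CharacterModule.congr eK
  haveI : Module.Finite (IwasawaAlgebra p) (CharacterModule (LinearMap.ker C)) :=
    Module.Finite.equiv eD.symm
  have htors : Module.IsTorsion (IwasawaAlgebra p) (CharacterModule (LinearMap.ker C)) :=
    isTorsion_of_linearEquiv eD.symm htorsE
  have hP : Polynomial.aeval (binomSeries ℤ_[p] (-(κ ψ).toAdd)) (LinearMap.charpoly Lt).reverse ∈
      Module.charIdeal (IwasawaAlgebra p) (CharacterModule (LinearMap.ker C)) := by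
    rw [Module.charIdeal_eq_of_linearEquiv eD]
    change _ ∈ Module.charIdeal (PowerSeries ℤ_[p]) (CharacterModule (LinearMap.ker E₂))
    rw [hChE]
    exact Ideal.mem_span_singleton_self _
  -- the frame
  exact moduleFinite_isTorsion_mem_charIdeal_dual_h1_bigRep_of_shift_data κ ρ N hdense htors hP

end Literature.NumberTheory.EllipticCurves.BigGaloisRep

end
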